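import Summits.AnomalousDissipation.AnomalousDissipation.Theorems.TaylorGreenLoudGalerkinStates.Negative.Anatomy
import Summits.AnomalousDissipation.AnomalousDissipation.Theses.RootDecompCycle1
import Summits.AnomalousDissipation.AnomalousDissipation.Theses.RootDecompCycle2A
import Summits.AnomalousDissipation.AnomalousDissipation.Theses.KolmogorovPincer
import Summits.AnomalousDissipation.AnomalousDissipation.Theses.SteadyMirrorGate
import Summits.AnomalousDissipation.AnomalousDissipation.Theses.ErgodicMirrorGate
import Summits.AnomalousDissipation.AnomalousDissipation.Theses.DegreeGate
import Summits.AnomalousDissipation.AnomalousDissipation.Theses.PumpSignGate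

/-!
# Support item `TaylorGreenForceRegularTG` (stmt-AnomalousDissipation-24257) for the decomp-ad cell routes

The pinned Taylor–Green force `f_TG = (sin 2πx₀ cos 2πx₁ cos 2πx₂, −cos 2πx₀ sin 2πx₁ cos 2πx₂, 0)` is smooth,
divergence free and mean zero.  The shared item stmt-AnomalousDissipation-24257 is carried VERBATIM by seven route files of
the decomp-ad cell (RootDecompCycle1, RootDecompCycle2A, KolmogorovPincer, SteadyMirrorGate, ErgodicMirrorGate, DegreeGate,
PumpSignGate); each copy is proved here exactly as `Theorems/MirrorEnsembleTaylorGreenForceRegularTG.lean` proves the older shared item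
stmt-AnomalousDissipation-15378 (routes MirrorEnsemble / PumpedMirror): substitute the pinned force, which is definitionally
`Negative.tgForce` of `Theorems/TaylorGreenLoudGalerkinStates/Negative/LoadBearing.lean`, and quote the landed corollaries
`Negative.isSmooth_tgForce`, `Negative.isDivFree_tgForce`, `Negative.hasZeroMean_tgForce` (`…/Negative/Anatomy.lean`: `f_TG` is the real
trigonometric polynomial on the shell `|k|² = 3`).  (The term-level lemma `Theorems.taylorGreenForce_regular` of that file is not re-stated
here; its module is not imported to keep this file's build independent of it.)  Landed by the cell's prover seat.  Nothing here proves the summit.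
Reference (folklore): Brachet–Meiron–Orszag–Nickel–Morf–Frisch, J. Fluid Mech. 130 (1983) §2.
-/

set_option linter.dupNamespace false

noncomputable section

namespace Summit.AnomalousDissipation.AnomalousDissipation.Theorems.TaylorGreenForceRegular

open Literature.Analysis.FunctionSpaces Literature.Analysis.FunctionSpaces.Torus
open Summit.AnomalousDissipation.AnomalousDissipation.Theses
open Summit.AnomalousDissipation.AnomalousDissipation.Theorems.TaylorGreenLoudGalerkinStates.Negative

/-- Route decl `RootDecompCycle1.TaylorGreenForceRegularTG` (stmt-AnomalousDissipation-24257), proved. [folklore] -/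
theorem rootDecompCycle1_taylorGreenForceRegularTG : RootDecompCycle1.TaylorGreenForceRegularTG := by
  unfold RootDecompCycle1.TaylorGreenForceRegularTG
  intro f hf
  subst hf
  exact ⟨isSmooth_tgForce, isDivFree_tgForce, hasZeroMean_tgForce⟩

/-- Route decl `RootDecompCycle2A.TaylorGreenForceRegularTG` (stmt-AnomalousDissipation-24257), proved. [folklore] -/
theorem rootDecompCycle2A_taylorGreenForceRegularTG : RootDecompCycle2A.TaylorGreenForceRegularTG := by
  unfold RootDecompCycle2A.TaylorGreenForceRegularTG
  intro f hf
  subst hf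
  exact ⟨isSmooth_tgForce, isDivFree_tgForce, hasZeroMean_tgForce⟩

/-- Route decl `KolmogorovPincer.TaylorGreenForceRegularTG` (stmt-AnomalousDissipation-24257), proved. [folklore] -/
theorem kolmogorovPincer_taylorGreenForceRegularTG : KolmogorovPincer.TaylorGreenForceRegularTG := by
  unfold KolmogorovPincer.TaylorGreenForceRegularTG
  intro f hf
  subst hf
  exact ⟨isSmooth_tgForce, isDivFree_tgForce, hasZeroMean_tgForce⟩

/-- Route decl `SteadyMirrorGate.TaylorGreenForceRegularTG` (stmt-AnomalousDissipation-24257), proved. [folklore] -/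
theorem steadyMirrorGate_taylorGreenForceRegularTG : SteadyMirrorGate.TaylorGreenForceRegularTG := by
  unfold SteadyMirrorGate.TaylorGreenForceRegularTG
  intro f hf
  subst hf
  exact ⟨isSmooth_tgForce, isDivFree_tgForce, hasZeroMean_tgForce⟩

/-- Route decl `ErgodicMirrorGate.TaylorGreenForceRegularTG` (stmt-AnomalousDissipation-24257), proved. [folklore] -/
theorem ergodicMirrorGate_taylorGreenForceRegularTG : ErgodicMirrorGate.TaylorGreenForceRegularTG := by
  unfold ErgodicMirrorGate.TaylorGreenForceRegularTG
  intro f hf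
  subst hf
  exact ⟨isSmooth_tgForce, isDivFree_tgForce, hasZeroMean_tgForce⟩

/-- Route decl `DegreeGate.TaylorGreenForceRegularTG` (stmt-AnomalousDissipation-24257), proved. [folklore] -/
theorem degreeGate_taylorGreenForceRegularTG : DegreeGate.TaylorGreenForceRegularTG := by
  unfold DegreeGate.TaylorGreenForceRegularTG
  intro f hf
  subst hf
  exact ⟨isSmooth_tgForce, isDivFree_tgForce, hasZeroMean_tgForce⟩

/-- Route decl `PumpSignGate.TaylorGreenForceRegularTG` (stmt-AnomalousDissipation-24257), proved. [folklore] -/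
theorem pumpSignGate_taylorGreenForceRegularTG : PumpSignGate.TaylorGreenForceRegularTG := by
  unfold PumpSignGate.TaylorGreenForceRegularTG
  intro f hf
  subst hf
  exact ⟨isSmooth_tgForce, isDivFree_tgForce, hasZeroMean_tgForce⟩

end Summit.AnomalousDissipation.AnomalousDissipation.Theorems.TaylorGreenForceRegular

end
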